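import Summits.CriticalPhenomena.Ising3DConformalLimit.Theses.AnomalousForcesInteraction
import Literature.Probability.LatticeModels.CriticalScalingDimension
import Literature.Probability.LatticeModels.CriticalTwoPointBounds
import HarnessLib

/-!
# `AnomalousForcesInteraction.DeltaLowerBound` (item stmt-CriticalPhenomena-2602), proved

THEOREM-ONLY file (no definitions, no named facts). The glue item `DeltaLowerBound` of routes
`AnomalousForcesInteraction` (support #9) and `OctaveForgetting` (verbatim copy): a lattice upper
bound `⟨σ₀σ_x⟩_{β_c} ≤ C‖x‖^{-a}` (`x ≠ 0`) forces `a ≤ 2Δ` for every scale-covariant,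
non-degenerate pointwise scaling limit `(ρ, Δ, S)` of the critical correlators on `ℤ³`
(renormalisation `ρ > 0` on `(0,1]`); no rotation or translation invariance is used.

Proof = the dyadic argument of `scalingDimension_mem_Icc_of_bounds`
(`Literature/Probability/LatticeModels/CriticalScalingDimension.lean`) with `C‖x‖^{-a}` in place
of `C‖x‖⁻¹`: along `x_k = 2^{k+1}e₁`, `ρ(δ_k)²G(x_k) → S₂(0,e) > 0` (`tendsto_rescaled_dyadic`)
and `log ρ(δ_k)²/k → 2Δ log 2` (`tendsto_log_rho_sq_div`), while `log G(x_k) ≤ log C − a(k+1)log 2`;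
positivity of `G` (hence of `C`) is the Simon–Lieb lower bound of the discharged two-point bounds
`criticalTwoPoint_bounds_holds`. Landed from the session on item stmt-CriticalPhenomena-1343
(`PerfectScreening.GaussianLimitIsCoulomb`), where `EtaPositive ∧ GaussianLimitIsFree ∧
DeltaLowerBound` is one of the (vacuous) closure paths of that item.

References: B. Simon, CMP 77 (1980) 111; E. Lieb, CMP 77 (1980) 127; J. Fröhlich, B. Simon,
T. Spencer, CMP 50 (1976) 79; H. Duminil-Copin, *Lectures on the Ising and Potts models* (2019)
Thm 4.8.
-/

noncomputable section

namespace Summit.CriticalPhenomena.Ising3DConformalLimit.Theorems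

open Literature.Probability.LatticeModels Filter Set
open scoped Topology
open Summit.CriticalPhenomena.Ising3DConformalLimit.Theses

/-- **`DeltaLowerBound` (item stmt-CriticalPhenomena-2602 of routes `AnomalousForcesInteraction` /
`OctaveForgetting`), proved**: a lattice upper bound `⟨σ₀σ_x⟩_{β_c} ≤ C‖x‖^{-a}` (`x ≠ 0`) forces
`a ≤ 2Δ` for every scale-covariant, non-degenerate pointwise scaling limit (renormalisation
`ρ > 0` on `(0,1]`) — no rotation or translation invariance needed. The dyadic argument of
`scalingDimension_mem_Icc_of_bounds` (`CriticalScalingDimension.lean`) with `C‖x‖^{-a}` in place of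
`C‖x‖⁻¹`: along `x_k = 2^{k+1}e₁`, `ρ(δ_k)²G(x_k) → S₂(0,e) > 0` and `log ρ(δ_k)²/k → 2Δ log 2`,
while `log G(x_k) ≤ log C − a(k+1) log 2`; positivity of `G` is the tree's Simon–Lieb lower bound
(`criticalTwoPoint_bounds_holds`). With `EtaPositive` (2600) and `GaussianLimitIsFree` (2601) it
is the third hypothesis of that route's deciding theorem. Settles item stmt-CriticalPhenomena-2602
(exact signature). [folklore] -/
theorem DeltaLowerBound_proof : AnomalousForcesInteraction.DeltaLowerBound := by
  intro a C ρ Δ S hupp hρ hlim hnd hsc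
  obtain ⟨c₀, C₀, hc₀, hbd⟩ := criticalTwoPoint_bounds_holds (d := 3) le_rfl
  set δ : ℕ → ℝ := fun k => (2 : ℝ)⁻¹ ^ (k + 1) with hδ
  set x : ℕ → Site 3 := fun k => Pi.single (0 : Fin 3) (((1 : ℕ) : ℤ) * 2 ^ (k + 1)) with hx
  set G : ℕ → ℝ := fun k => criticalTwoPoint 3 (x k) with hG
  set r : ℕ → ℝ := fun k => ρ (δ k) ^ 2 * G k with hr
  set s₁ := S 2 ![0, EuclideanSpace.single (0 : Fin 3) ((1 : ℕ) : ℝ)] with hs₁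
  have hs₁pos : 0 < s₁ := hnd _ (zero_unitVec_mem_nonCoincident (by norm_num))
  have hρk : ∀ k : ℕ, 0 < ρ (δ k) := fun k => hρ _ ⟨dyadicMesh_pos k, dyadicMesh_le_one k⟩
  have hxne : ∀ k, x k ≠ 0 := by
    intro k h
    have := congrFun h 0
    simp [hx] at this
  have hnorm : ∀ k, (‖x k‖ : ℝ) = 2 ^ (k + 1) := by
    intro k
    rw [hx, norm_single_axis]
    push_cast
    rw [one_mul, abs_of_pos (by positivity)]
  have hGpos : ∀ k, 0 < G k := fun k =>
    lt_of_lt_of_le (mul_pos hc₀ (Real.rpow_pos_of_pos (norm_pos_iff.2 (hxne k)) _))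
      (hbd (x k) (hxne k)).1
  have hpowpos : ∀ k : ℕ, (0 : ℝ) < ((2 : ℝ) ^ (k + 1)) ^ (-a) := fun k =>
    Real.rpow_pos_of_pos (by positivity) _
  have hupp' : ∀ k, G k ≤ C * ((2 : ℝ) ^ (k + 1)) ^ (-a) := by
    intro k
    have h := hupp (x k) (hxne k)
    rw [hnorm k] at h
    exact h
  have hCpos : 0 < C := by
    by_contra hC
    push Not at hC
    have h := (hGpos 0).trans_le (hupp' 0)
    nlinarith [hpowpos 0]
  -- `r k → s₁ > 0`, hence eventually `s₁/2 ≤ r k`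
  have hrlim : Tendsto r atTop (𝓝 s₁) := tendsto_rescaled_dyadic hlim (t := 1) one_ne_zero
  have hr_ev : ∀ᶠ k in atTop, s₁ / 2 ≤ r k :=
    (hrlim.eventually_const_lt (by linarith)).mono fun k hk => hk.le
  -- the main limit `log ρ(δ_k)² / k → 2Δ log 2`
  have hmain := tendsto_log_rho_sq_div hlim hsc hnd hρ
  have hlog2 : 0 < Real.log 2 := Real.log_pos (by norm_num)
  have hlogeq : ∀ k, Real.log (ρ (δ k) ^ 2) = Real.log (r k) - Real.log (G k) := by
    intro k
    rw [hr]
    simp only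
    rw [Real.log_mul (pow_ne_zero _ (hρk k).ne') (hGpos k).ne']
    ring
  have hpowlog : ∀ k : ℕ, Real.log (((2 : ℝ) ^ (k + 1)) ^ (-a)) = -(a * ((k + 1 : ℝ) * Real.log 2)) := by
    intro k
    rw [Real.log_rpow (by positivity), Real.log_pow]
    push_cast
    ring
  -- lower bound on `log ρ(δ_k)² / k` from the upper bound on `G`
  have hLB : ∀ᶠ k : ℕ in atTop,
      (Real.log (s₁ / 2) - Real.log C + a * ((k + 1 : ℝ) * Real.log 2)) / k ≤
        Real.log (ρ (δ k) ^ 2) / k := by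
    filter_upwards [hr_ev, eventually_gt_atTop 0] with k hrk hk
    have hk' : (0 : ℝ) < k := by exact_mod_cast hk
    rw [div_le_div_iff_of_pos_right hk', hlogeq k]
    have h1 : Real.log (G k) ≤ Real.log C + Real.log (((2 : ℝ) ^ (k + 1)) ^ (-a)) := by
      rw [← Real.log_mul hCpos.ne' (hpowpos k).ne']
      exact Real.log_le_log (hGpos k) (hupp' k)
    have h2 : Real.log (s₁ / 2) ≤ Real.log (r k) := Real.log_le_log (by positivity) hrk
    rw [hpowlog k] at h1
    linarith
  have hinvk : Tendsto (fun k : ℕ => (k : ℝ)⁻¹) atTop (𝓝 0) :=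
    tendsto_inv_atTop_zero.comp tendsto_natCast_atTop_atTop
  have hLBlim : Tendsto (fun k : ℕ =>
      (Real.log (s₁ / 2) - Real.log C + a * ((k + 1 : ℝ) * Real.log 2)) / k)
      atTop (𝓝 (a * Real.log 2)) := by
    have h : ∀ k : ℕ, 0 < k →
        (Real.log (s₁ / 2) - Real.log C + a * ((k + 1 : ℝ) * Real.log 2)) / k =
          (Real.log (s₁ / 2) - Real.log C + a * Real.log 2) * (k : ℝ)⁻¹ + a * Real.log 2 := by
      intro k hk
      have hk' : (k : ℝ) ≠ 0 := by exact_mod_cast hk.ne'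
      field_simp
      ring
    have hl := (hinvk.const_mul (Real.log (s₁ / 2) - Real.log C + a * Real.log 2)).add_const
      (a * Real.log 2)
    rw [mul_zero, zero_add] at hl
    refine hl.congr' ?_
    filter_upwards [eventually_gt_atTop 0] with k hk using (h k hk).symm
  have hge : a * Real.log 2 ≤ 2 * Δ * Real.log 2 := le_of_tendsto_of_tendsto hLBlim hmain hLB
  exact le_of_mul_le_mul_right hge hlog2

end Summit.CriticalPhenomena.Ising3DConformalLimit.Theorems

end
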